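import Mathlib.RingTheory.PowerSeries.Expand
import Mathlib.Algebra.CharP.Lemmas
import HarnessLib

/-!
# The theta factor of (CutForm⁶) in characteristic `p`: the Frobenius shape of `T = Θ^p mod p` and its support
# (LEAD g13's glue piece (G2))

Width seat `bsd-line-cfram-p1-w8` g7 on crux stmt-BirchSwinnertonDyer-20372
`PrintCFram.BottomClassIndexLawFiveLe`, line `eisenstein-resource-bdp-line`, registry v23. The registered
stub `stub_cutForm` ((CutForm⁶), the `hcut` binder of `ThetaCycle.atP_six_of_cutForm`) asks, over a field
`𝔽` of characteristic `p`, for power series `G, T` with `G·T` in a Katz family, `T ≠ 0`,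
`coeff j T ≠ 0 → p ∣ j`, and `G` supported on a periodic index set (the refined `m`-cut, period `Q`).
On the complex side (`…HalfIntegralBridge`, `…ThetaQExpansion`, NF-C of
`Literature.NumberTheory.ModularForms.ModularFormPeriodicTwist`) one produces the modular form
`cut_S(H_k · θ(Q²·)^p)` and its `q`-expansion `cut_S(qExpansion H_k · Θ^p) = cut_S(qExpansion H_k) · Θ^p`
(the cut commutes with the `Q`-supported factor `Θ^p`: w3 g12's
`PowerSeries.coeff_mul_eq_mul_coeff_mul_of_periodic` in `…CutFormPeriodicCut`, not repeated here); to read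
its reduction as `G · T` with `T = Θ^p mod p` one needs the shape of `Θ^p` in characteristic `p`, supplied
here for ANY coefficient ring:

* §1 **`coeff_pow_eq_zero_of_not_dvd`** (`ExpChar R p`): `coeff j (Θ^p) = 0` unless `p ∣ j`
  (`Θ^p = Frob(expand_p Θ)`, Mathlib `MvPowerSeries.map_frobenius_expand`); `constantCoeff (Θ^p) =
  (constantCoeff Θ)^p`; hence **`map_pow_ne_zero_and_dvd_of_coeff_ne_zero`**: for `Θ ∈ ℕ⟦q⟧` with
  constant term `1` and `𝔽` of prime characteristic `p`, `T := (Θ mod p)^p` satisfies `T ≠ 0` and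
  `coeff j T ≠ 0 → p ∣ j` — the two `T`-clauses of (CutForm⁶) VERBATIM.
* §2 supports: if `ψ` is supported on multiples of `Q` then so is `ψ^n` and `ψ.map f`; supports in
  `{Q² m²}` (the `q`-expansion of `θ(Q²z)`, `…ThetaQExpansion.exists_powerSeries_nat_qExpansion_thetaMul`)
  lie in the multiples of `Q`; **`T_side`**: `T := (Θ mod p)^p` is non-zero, `p`-supported and
  `Q`-supported (the hypothesis under which the periodic cut mod `Q` commutes with `· T`).

No definitions, no named facts, no `sorry`; elementary. BSD is not proved by any of this; no summit
statement is proved by this seat; no registered stub is closed by this file.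
-/

set_option autoImplicit false
-- summit-side namespace (single-conjunct summit, D-0017 layout)
set_option linter.dupNamespace false

namespace Summit.BirchSwinnertonDyer.BirchSwinnertonDyer.Theorems.PrintCFram.ThetaFrobenius

/-! ## §1 The Frobenius shape of `Θ^p` in characteristic `p` -/

/-- **`coeff j (Θ^p) = 0` unless `p ∣ j`** over a ring of exponential characteristic `p`
(`Θ^p = Frob (expand_p Θ)`, Mathlib `MvPowerSeries.map_frobenius_expand`, and `expand_p Θ` is supported
on multiples of `p`). [folklore] -/
theorem coeff_pow_eq_zero_of_not_dvd {R : Type*} [CommRing R] (p : ℕ) [ExpChar R p] (hp : p ≠ 0)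
    (Θ : PowerSeries R) {j : ℕ} (hj : ¬ p ∣ j) : PowerSeries.coeff j (Θ ^ p) = 0 := by
  have h : PowerSeries.map (frobenius R p) (PowerSeries.expand p hp Θ) = Θ ^ p :=
    MvPowerSeries.map_frobenius_expand p hp (f := Θ)
  rw [← h, PowerSeries.coeff_map, PowerSeries.coeff_expand_of_not_dvd p hp Θ hj, map_zero]

/-- `coeff j (Θ^p) ≠ 0 ⟹ p ∣ j` (contrapositive form, as in (CutForm⁶)). [folklore] -/
theorem dvd_of_coeff_pow_ne_zero {R : Type*} [CommRing R] (p : ℕ) [ExpChar R p] (hp : p ≠ 0)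
    (Θ : PowerSeries R) {j : ℕ} (hj : PowerSeries.coeff j (Θ ^ p) ≠ 0) : p ∣ j := by
  by_contra h
  exact hj (coeff_pow_eq_zero_of_not_dvd p hp Θ h)

/-- `constantCoeff (Θ^n) = (constantCoeff Θ)^n`. [folklore] -/
theorem constantCoeff_pow {R : Type*} [CommSemiring R] (Θ : PowerSeries R) (n : ℕ) :
    PowerSeries.constantCoeff (Θ ^ n) = PowerSeries.constantCoeff Θ ^ n :=
  map_pow _ Θ n

/-- **The two `T`-clauses of (CutForm⁶)**: for `Θ ∈ ℕ⟦q⟧` with constant term `1` (e.g. the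
`q`-expansion of `θ(Q²z)`, `…ThetaQExpansion.exists_powerSeries_nat_qExpansion_thetaMul`) and any
commutative ring `𝔽` of prime characteristic `p`, `T := (Θ.map (ℕ → 𝔽))^p` satisfies `T ≠ 0` and
`coeff j T ≠ 0 → p ∣ j`. [folklore] -/
theorem map_pow_ne_zero_and_dvd_of_coeff_ne_zero {𝔽 : Type*} [CommRing 𝔽] (p : ℕ) [Fact p.Prime]
    [CharP 𝔽 p] (Θ : PowerSeries ℕ) (h0 : PowerSeries.coeff 0 Θ = 1) :
    (PowerSeries.map (Nat.castRingHom 𝔽) Θ) ^ p ≠ 0 ∧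
      ∀ j : ℕ, PowerSeries.coeff j ((PowerSeries.map (Nat.castRingHom 𝔽) Θ) ^ p) ≠ 0 → p ∣ j := by
  haveI : ExpChar 𝔽 p := ExpChar.prime (Fact.out : p.Prime)
  haveI : Nontrivial 𝔽 := CharP.nontrivial_of_char_ne_one (R := 𝔽) (Fact.out : p.Prime).ne_one
  have hp : p ≠ 0 := (Fact.out : p.Prime).ne_zero
  refine ⟨fun h ↦ ?_, fun j hj ↦ dvd_of_coeff_pow_ne_zero p hp _ hj⟩
  have h1 : PowerSeries.coeff 0 ((PowerSeries.map (Nat.castRingHom 𝔽) Θ) ^ p) = 1 := by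
    rw [PowerSeries.coeff_zero_eq_constantCoeff, constantCoeff_pow,
      ← PowerSeries.coeff_zero_eq_constantCoeff, PowerSeries.coeff_map, h0, map_one, one_pow]
  rw [h, map_zero] at h1
  exact zero_ne_one h1

/-! ## §2 Supports -/

/-- If `ψ` is supported on multiples of `Q` then so is every power `ψ^n`. [folklore] -/
theorem dvd_of_coeff_pow_ne_zero_of_forall {R : Type*} [CommSemiring R] {Q : ℕ} (ψ : PowerSeries R)
    (hψ : ∀ j : ℕ, PowerSeries.coeff j ψ ≠ 0 → Q ∣ j) (n : ℕ) :
    ∀ j : ℕ, PowerSeries.coeff j (ψ ^ n) ≠ 0 → Q ∣ j := by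
  induction n with
  | zero =>
    intro j hj
    rw [pow_zero, PowerSeries.coeff_one] at hj
    split_ifs at hj with h
    · rw [h]; exact dvd_zero Q
    · exact absurd rfl hj
  | succ n ih =>
    intro j hj
    rw [pow_succ, PowerSeries.coeff_mul] at hj
    obtain ⟨ij, hmem, hne⟩ := Finset.exists_ne_zero_of_sum_ne_zero hj
    have h1 : PowerSeries.coeff ij.1 (ψ ^ n) ≠ 0 := fun h ↦ hne (by rw [h, zero_mul])
    have h2 : PowerSeries.coeff ij.2 ψ ≠ 0 := fun h ↦ hne (by rw [h, mul_zero])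
    rw [← Finset.mem_antidiagonal.mp hmem]
    exact dvd_add (ih ij.1 h1) (hψ ij.2 h2)

/-- Ring maps do not enlarge supports: if `ψ` is supported on multiples of `Q`, so is `ψ.map f`.
[folklore] -/
theorem dvd_of_coeff_map_ne_zero {R S : Type*} [CommSemiring R] [CommSemiring S] (f : R →+* S) {Q : ℕ}
    (ψ : PowerSeries R) (hψ : ∀ j : ℕ, PowerSeries.coeff j ψ ≠ 0 → Q ∣ j) :
    ∀ j : ℕ, PowerSeries.coeff j (PowerSeries.map f ψ) ≠ 0 → Q ∣ j := by
  intro j hj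
  rw [PowerSeries.coeff_map] at hj
  exact hψ j fun h ↦ hj (by rw [h, map_zero])

/-- Supports in `{t m²}` (the `q`-expansion of `θ(tz)`) lie in the multiples of `t`; for `t = Q²` in the
multiples of `Q`. [folklore] -/
theorem dvd_of_support_sq {Θ : PowerSeries ℕ} {Q : ℕ}
    (hΘ : ∀ n : ℕ, PowerSeries.coeff n Θ ≠ 0 → ∃ m : ℕ, n = Q ^ 2 * m ^ 2) :
    ∀ j : ℕ, PowerSeries.coeff j Θ ≠ 0 → Q ∣ j := by
  intro j hj
  obtain ⟨m, rfl⟩ := hΘ j hj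
  exact ⟨Q * m ^ 2, by ring⟩

/-- **Assembly of the `T`-side for (CutForm⁶)**: from `Θ ∈ ℕ⟦q⟧` with constant term `1` and support in
`{Q² m²}` (the `q`-expansion of `θ(Q²z)`), over any `𝔽` of prime characteristic `p`: `T := (Θ mod p)^p`
is non-zero, `p`-supported, and `Q`-supported (so periodic multipliers mod `Q` commute with `· T`, w3 g12's
`PowerSeries.coeff_mul_eq_mul_coeff_mul_of_periodic`). [folklore] -/
theorem T_side {𝔽 : Type*} [CommRing 𝔽] (p : ℕ) [Fact p.Prime] [CharP 𝔽 p] {Q : ℕ}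
    (Θ : PowerSeries ℕ) (h0 : PowerSeries.coeff 0 Θ = 1)
    (hΘ : ∀ n : ℕ, PowerSeries.coeff n Θ ≠ 0 → ∃ m : ℕ, n = Q ^ 2 * m ^ 2) :
    (PowerSeries.map (Nat.castRingHom 𝔽) Θ) ^ p ≠ 0 ∧
      (∀ j : ℕ, PowerSeries.coeff j ((PowerSeries.map (Nat.castRingHom 𝔽) Θ) ^ p) ≠ 0 → p ∣ j) ∧
      (∀ j : ℕ, PowerSeries.coeff j ((PowerSeries.map (Nat.castRingHom 𝔽) Θ) ^ p) ≠ 0 → Q ∣ j) := by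
  obtain ⟨hne, hdvd⟩ := map_pow_ne_zero_and_dvd_of_coeff_ne_zero (𝔽 := 𝔽) p Θ h0
  exact ⟨hne, hdvd, dvd_of_coeff_pow_ne_zero_of_forall _
    (dvd_of_coeff_map_ne_zero (Nat.castRingHom 𝔽) Θ (dvd_of_support_sq hΘ)) p⟩

end Summit.BirchSwinnertonDyer.BirchSwinnertonDyer.Theorems.PrintCFram.ThetaFrobenius
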